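import Mathlib
import Summits.ValiantsHypothesis.ValiantsHypothesis.Theorems.BarrierLeverPartitionMinorsHitByVPHiddenStatesBall

/-!
# Route BarrierLever — item `PartitionMinorsHitByVP` (stmt-ValiantsHypothesis-19717):
# the STAR OBSTRUCTION for EVERY `h ≥ 6`, part 1/2 — the row family, the hidden family, the threshold property

Helper file (`--supports stmt-ValiantsHypothesis-19717`; cell valiant-natproofs, rung V4, 𝒟-side of door (c); prover seat
val-np-p3 gen 8). Closes NO item. Parametric version of `…HiddenStatesStar` (`not_ballGood_star6`, seat g7).

For every `n` put `h = K = n + 6` and `r = (n + 7) + 5`. The row family `pstarU n` = `∅`, the `h` singletons, the 5-star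
`{0,1},…,{0,5}`; the ball–colex hidden family of size `r` on `K = h` states is `pstarE n` = `∅`, the `K` singletons,
`{0,1},{0,2},{1,2},{0,3},{1,3}` (`pstarE_threshold`). For EVERY table the additive matrix is singular (`det_pM_eq_zero`):
the five star rows `ℓ_0 ℓ_{b}` combine (a nonzero `β` with `Σ_b β_b t_{q,b} = 0` for the four states `q ≤ 3` carrying the
hidden pairs — four equations, five unknowns) into a function that is AFFINE on the hidden family (`sum_star_rows`), and
together with the `h + 1` affine rows `∅, {a}` these are `h + 2` vectors from the `(h+1)`-dimensional space of affine
coefficient vectors — dependent (`exists_dependence`, a zero-row padding of the coefficient matrix). THIS FILE (part 1): the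
families `pstarU n`, `pstarE n`, their injectivity, and `pstarE_threshold` (the members weigh `≤ 2·2^K + 10`, every other subset
more: `mem_range_pstarE_of_le`). Part 2 (`…HiddenStatesStarParam`) proves the singularity and `¬ BallGood`.
WHAT THIS IS NOT: nothing on `K > h`, on CPM, crux 14610 or VP ≠ VNP.
-/

set_option linter.dupNamespace false

namespace Summit.ValiantsHypothesis.ValiantsHypothesis.Theorems.BarrierLever.HiddenStates

open Finset Matrix

noncomputable section

namespace StarParam

variable (n : ℕ)

/-- The state / coordinate `j < n + 6` as an element of `Fin (n + 6)`. -/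
def el (j : ℕ) (hj : j < n + 6 := by omega) : Fin (n + 6) := ⟨j, hj⟩

/-- Value of `el`. -/
@[simp] theorem el_val (j : ℕ) (hj : j < n + 6) : (el n j hj : ℕ) = j := rfl

/-- First members of the five hidden pairs `01, 02, 12, 03, 13` (as naturals). -/
def p1 : Fin 5 → ℕ := ![0, 0, 1, 0, 1]
/-- Second members of the five hidden pairs `01, 02, 12, 03, 13` (as naturals). -/
def p2 : Fin 5 → ℕ := ![1, 2, 2, 3, 3]

/-- First members are `< 4`. -/
theorem p1_lt (b : Fin 5) : p1 b < 4 := by fin_cases b <;> decide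
/-- Second members are `< 4`. -/
theorem p2_lt (b : Fin 5) : p2 b < 4 := by fin_cases b <;> decide
/-- The two members of a hidden pair differ. -/
theorem p1_ne_p2 (b : Fin 5) : p1 b ≠ p2 b := by fin_cases b <;> decide
/-- Binary weight of each hidden pair is at most `10`. -/
theorem pow_p1_add_pow_p2_le (b : Fin 5) : 2 ^ p1 b + 2 ^ p2 b ≤ 10 := by fin_cases b <;> decide

/-- The hidden pair number `b`. -/
def hpair (b : Fin 5) : Finset (Fin (n + 6)) :=
  {el n (p1 b) (by have := p1_lt b; omega), el n (p2 b) (by have := p2_lt b; omega)}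

/-- The two members of a hidden pair are distinct. -/
theorem el_p1_ne_el_p2 (b : Fin 5) :
    el n (p1 b) (by have := p1_lt b; omega) ≠ el n (p2 b) (by have := p2_lt b; omega) := by
  intro h
  have := congrArg Fin.val h
  simp only [el_val] at this
  exact p1_ne_p2 b this

/-- `∅` and the singletons, indexed by `Fin (n + 6 + 1)`: index `0 ↦ ∅`, index `a + 1 ↦ {a}`. -/
def small : Fin (n + 6 + 1) → Finset (Fin (n + 6)) := Fin.cases ∅ fun a => {a}

/-- Index `0` is the empty set. -/
@[simp] theorem small_zero : small n 0 = ∅ := by simp [small]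
/-- Index `a+1` is the singleton `{a}`. -/
@[simp] theorem small_succ (a : Fin (n + 6)) : small n a.succ = {a} := by simp [small]

/-- **The row family**: `∅`, the `n+6` singletons, and the 5-star `{0, b+1}`, `b < 5`. -/
def pstarU : Fin (n + 6 + 1 + 5) → Finset (Fin (n + 6)) :=
  Fin.addCases (small n) fun b => {el n 0, el n (b + 1) (by omega)}

/-- **The hidden family** (ball–colex of size `n + 12` on `n + 6` states): `∅`, all singletons, `01, 02, 12, 03, 13`. -/
def pstarE : Fin (n + 6 + 1 + 5) → Finset (Fin (n + 6)) :=
  Fin.addCases (small n) (hpair n)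

/-- First block of the row family. -/
@[simp] theorem pstarU_left (j : Fin (n + 6 + 1)) : pstarU n (Fin.castAdd 5 j) = small n j := by
  simp [pstarU]
/-- Second block of the row family: the star pairs `{0, b+1}`. -/
@[simp] theorem pstarU_right (b : Fin 5) :
    pstarU n (Fin.natAdd (n + 6 + 1) b) = {el n 0, el n (b + 1) (by omega)} := by
  simp [pstarU]
/-- First block of the hidden family. -/
@[simp] theorem pstarE_left (j : Fin (n + 6 + 1)) : pstarE n (Fin.castAdd 5 j) = small n j := by
  simp [pstarE]
/-- Second block of the hidden family: the five hidden pairs. -/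
@[simp] theorem pstarE_right (b : Fin 5) : pstarE n (Fin.natAdd (n + 6 + 1) b) = hpair n b := by
  simp [pstarE]

/-- `small` is injective. -/
theorem small_injective : Function.Injective (small n) := by
  intro i j hij
  induction i using Fin.cases with
  | zero =>
    induction j using Fin.cases with
    | zero => rfl
    | succ b => simp at hij
  | succ a =>
    induction j using Fin.cases with
    | zero => simp at hij
    | succ b => simp only [small_succ, Finset.singleton_inj] at hij; rw [hij]

/-- Members of the first block have at most one element. -/
theorem card_small_le (j : Fin (n + 6 + 1)) : (small n j).card ≤ 1 := by
  induction j using Fin.cases with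
  | zero => simp
  | succ a => simp

/-- Hidden pairs have two elements. -/
theorem card_hpair (b : Fin 5) : (hpair n b).card = 2 := by
  rw [hpair, Finset.card_pair (el_p1_ne_el_p2 n b)]

/-- The row family is injective. -/
theorem pstarU_injective : Function.Injective (pstarU n) := by
  intro i j hij
  induction i using Fin.addCases with
  | left i =>
    induction j using Fin.addCases with
    | left j => rw [pstarU_left, pstarU_left] at hij; rw [small_injective n hij]
    | right b =>
      exfalso
      rw [pstarU_left, pstarU_right] at hij
      have h1 := card_small_le n i
      have h0 : el n 0 ≠ el n (b + 1) (by omega) := by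
        intro h; have := congrArg Fin.val h; simp at this
      rw [hij, Finset.card_pair h0] at h1
      omega
  | right a =>
    induction j using Fin.addCases with
    | left j =>
      exfalso
      rw [pstarU_left, pstarU_right] at hij
      have h1 := card_small_le n j
      have h0 : el n 0 ≠ el n (a + 1) (by omega) := by
        intro h; have := congrArg Fin.val h; simp at this
      rw [← hij, Finset.card_pair h0] at h1
      omega
    | right b =>
      rw [pstarU_right, pstarU_right] at hij
      have hmem : el n (a + 1) (by omega) ∈ ({el n 0, el n (b + 1) (by omega)} : Finset (Fin (n + 6))) := by
        rw [← hij]; simp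
      rw [Finset.mem_insert, Finset.mem_singleton] at hmem
      rcases hmem with h | h
      · have := congrArg Fin.val h; simp at this
      · have := congrArg Fin.val h
        simp only [el_val, add_left_inj] at this
        congr 1
        exact Fin.ext this

/-- The hidden family is injective. -/
theorem pstarE_injective : Function.Injective (pstarE n) := by
  intro i j hij
  induction i using Fin.addCases with
  | left i =>
    induction j using Fin.addCases with
    | left j => rw [pstarE_left, pstarE_left] at hij; rw [small_injective n hij]
    | right b =>
      exfalso
      rw [pstarE_left, pstarE_right] at hij
      have h1 := card_small_le n i
      rw [hij, card_hpair] at h1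
      omega
  | right a =>
    induction j using Fin.addCases with
    | left j =>
      exfalso
      rw [pstarE_left, pstarE_right] at hij
      have h1 := card_small_le n j
      rw [← hij, card_hpair] at h1
      omega
    | right b =>
      rw [pstarE_right, pstarE_right] at hij
      have hv : ∀ b : Fin 5, ∑ k ∈ (hpair n b).map Fin.valEmbedding, 2 ^ k = 2 ^ p1 b + 2 ^ p2 b := by
        intro b
        rw [Finset.sum_map, hpair, Finset.sum_pair (el_p1_ne_el_p2 n b)]
        simp
      have hab : 2 ^ p1 a + 2 ^ p2 a = 2 ^ p1 b + 2 ^ p2 b := by rw [← hv, ← hv, hij]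
      congr 1
      revert hab
      fin_cases a <;> fin_cases b <;> decide

/-! ### The threshold property -/

/-- Every subset of weight at most `2·2^K + 10` belongs to the hidden family. -/
theorem mem_range_pstarE_of_le (J : Finset (Fin (n + 6)))
    (hJ : ∑ k ∈ J, ballWt (n + 6) k ≤ 2 * 2 ^ (n + 6) + 10) : J ∈ Set.range (pstarE n) := by
  rw [sum_ballWt] at hJ
  have hK : 64 ≤ 2 ^ (n + 6) := by
    calc (64 : ℕ) = 2 ^ 6 := by norm_num
      _ ≤ 2 ^ (n + 6) := Nat.pow_le_pow_right (by norm_num) (by omega)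
  have hcard : J.card ≤ 2 := by
    by_contra hc
    have h3 : 3 ≤ J.card := by omega
    have : 3 * 2 ^ (n + 6) ≤ J.card * 2 ^ (n + 6) := Nat.mul_le_mul_right _ h3
    omega
  rcases Nat.lt_or_ge J.card 1 with h0 | h1
  · -- `J = ∅`
    have hJ0 : J = ∅ := Finset.card_eq_zero.mp (show J.card = 0 by omega)
    exact ⟨Fin.castAdd 5 0, by rw [pstarE_left, small_zero, hJ0]⟩
  rcases Nat.lt_or_ge J.card 2 with h1' | h2
  · -- a singleton
    obtain ⟨a, ha⟩ := Finset.card_eq_one.mp (show J.card = 1 by omega)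
    exact ⟨Fin.castAdd 5 a.succ, by rw [pstarE_left, small_succ, ha]⟩
  · -- a pair of small binary weight
    obtain ⟨a, b, hab, hJab⟩ := Finset.card_eq_two.mp (show J.card = 2 by omega)
    have hbin : ∑ k ∈ J.map Fin.valEmbedding, 2 ^ k ≤ 10 := by
      have hc2 : J.card = 2 := by omega
      rw [hc2] at hJ; omega
    rw [hJab, Finset.sum_map, Finset.sum_pair hab] at hbin
    simp only [Fin.valEmbedding_apply] at hbin
    -- both values are at most 3 and the pair is one of the five
    have ha3 : (a : ℕ) ≤ 3 := by
      by_contra hcon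
      have h16 : 2 ^ 4 ≤ 2 ^ (a : ℕ) := Nat.pow_le_pow_right (by norm_num) (by omega)
      have h10 : 2 ^ (a : ℕ) ≤ 10 := le_trans (Nat.le_add_right _ _) hbin
      have : (2 : ℕ) ^ 4 = 16 := by norm_num
      omega
    have hb3 : (b : ℕ) ≤ 3 := by
      by_contra hcon
      have h16 : 2 ^ 4 ≤ 2 ^ (b : ℕ) := Nat.pow_le_pow_right (by norm_num) (by omega)
      have h10 : 2 ^ (b : ℕ) ≤ 10 := le_trans (Nat.le_add_left _ _) hbin
      have : (2 : ℕ) ^ 4 = 16 := by norm_num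
      omega
    have hne : (a : ℕ) ≠ (b : ℕ) := fun h => hab (Fin.ext h)
    -- enumerate
    have key : ∀ av bv : ℕ, av ≤ 3 → bv ≤ 3 → av ≠ bv → 2 ^ av + 2 ^ bv ≤ 10 →
        ∃ c : Fin 5, (p1 c = av ∧ p2 c = bv) ∨ (p1 c = bv ∧ p2 c = av) := by
      intro av bv ha hb hne hle
      interval_cases av <;> interval_cases bv <;> simp_all (config := {decide := true})
    obtain ⟨c, hc⟩ := key a b ha3 hb3 hne hbin
    refine ⟨Fin.natAdd (n + 6 + 1) c, ?_⟩
    rw [pstarE_right, hJab, hpair]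
    rcases hc with ⟨h1c, h2c⟩ | ⟨h1c, h2c⟩
    · congr 1
      · exact Fin.ext (by simp [h1c])
      · exact congrArg _ (Fin.ext (by simp [h2c]))
    · rw [Finset.pair_comm]
      congr 1
      · exact Fin.ext (by simp [h2c])
      · exact congrArg _ (Fin.ext (by simp [h1c]))

/-- Every member of the hidden family has weight at most `2·2^K + 10`. -/
theorem wt_pstarE_le (i : Fin (n + 6 + 1 + 5)) : ∑ k ∈ pstarE n i, ballWt (n + 6) k ≤ 2 * 2 ^ (n + 6) + 10 := by
  rw [sum_ballWt]
  induction i using Fin.addCases with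
  | left j =>
    rw [pstarE_left]
    have hc := card_small_le n j
    have hb := sum_two_pow_lt (n + 6) (small n j)
    have := Nat.mul_le_mul_right (2 ^ (n + 6)) hc
    omega
  | right b =>
    rw [pstarE_right, card_hpair]
    have hv : ∑ k ∈ (hpair n b).map Fin.valEmbedding, 2 ^ k = 2 ^ p1 b + 2 ^ p2 b := by
      rw [Finset.sum_map, hpair, Finset.sum_pair (el_p1_ne_el_p2 n b)]
      simp
    rw [hv]
    have := pow_p1_add_pow_p2_le b
    omega

/-- **`pstarE` is a threshold family** for the ball–colex weight: every subset outside it is heavier than every member. -/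
theorem pstarE_threshold (J : Finset (Fin (n + 6))) (hJ : J ∉ Set.range (pstarE n)) (i : Fin (n + 6 + 1 + 5)) :
    ∑ k ∈ pstarE n i, ballWt (n + 6) k < ∑ k ∈ J, ballWt (n + 6) k := by
  have h1 := wt_pstarE_le n i
  have h2 : ¬ (∑ k ∈ J, ballWt (n + 6) k ≤ 2 * 2 ^ (n + 6) + 10) := fun h => hJ (mem_range_pstarE_of_le n J h)
  omega

end StarParam

end

end Summit.ValiantsHypothesis.ValiantsHypothesis.Theorems.BarrierLever.HiddenStates
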